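import Mathlib
import Literature.MathematicalPhysics.StatisticalMechanics.Crystallization
import Literature.MathematicalPhysics.StatisticalMechanics.LennardJonesClusters
import Literature.MathematicalPhysics.StatisticalMechanics.OneCrossingMixture
import Summits.AtomisticToContinuum.Crystallization.Theses.ReggeStarCoercivity
import Summits.AtomisticToContinuum.Crystallization.Theorems.ReggeStarCoercivityStabilityConstantTwelveStubReduction
import Summits.AtomisticToContinuum.Crystallization.Theorems.ReggeStarCoercivityStabilityConstantTwelveStubGaussSumMono
import Summits.AtomisticToContinuum.Crystallization.Theorems.ReggeStarCoercivityStabilityConstantTwelveStubEngine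
import Summits.AtomisticToContinuum.Crystallization.Theorems.ReggeStarCoercivityStabilityConstantTwelveStubCertAnalytic
import Summits.AtomisticToContinuum.Crystallization.Theorems.ReggeStarCoercivityStabilityConstantTwelveStubCertCrossing
import Summits.AtomisticToContinuum.Crystallization.Theorems.ReggeStarCoercivityStabilityConstantTwelveStubHermitePd
import Summits.AtomisticToContinuum.Crystallization.Theorems.ReggeStarCoercivityStabilityConstantTwelveStubCertNumeric

/-!
# Route `ReggeStarCoercivity`, crux stmt-AtomisticToContinuum-13601 `StabilityConstantTwelve`

`E(N) ≥ -N` for the Lennard-Jones ground-state energy of `N` distinct points in `ℝ³`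
(Blanc–Lewin units `V_LJ(r) = r⁻¹²/12 - r⁻⁶/6`), i.e. a certified stability constant
`B_LJ ≤ 12 ε` — in fact the certificate gives `E(N) ≥ -0.94705 N` (`B_LJ ≤ 11.37 ε`), improving
Yuhjtman's `14.316 ε` (arXiv:1501.05248, Thm 9; tree `Yuhjtman2015_stabilityConstant_holds`).

## Proof (line `Sketch` of the crux chain: two-point minorant, Fisher–Ruelle / Cohn–Kumar 9.3)

A function `g` of the squared distance with `Σ_{i,j} g(|x_i - x_j|²) ≥ 0` for every finite
configuration, `g(r²) ≤ V_LJ(r)` for `r > 0` and `g(0) ≤ 2` gives `2 𝓔_N(x) ≥ Σ_{i≠j} g = Σ_{i,j} g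
- N g(0) ≥ -2N` (`stub_reduction`). The certificate is HYBRID:
`g(u) = c₁ (u - uₛ) e^{-t₀ u} + Σ_{q<5} b_q (σ/(σ+u))^{q+2}` with explicit rationals
(`stub_cert_numeric`: `t₀ = 5/2`, `uₛ = 3/5`, `σ = 3`, …, `g(0) = 1.8940890…`).
* The rational piece is a Gaussian mixture `∫_0^∞ e^{-tu} a(t) dt` of a ONE-CROSSING density
  `a(t) = e^{-σt}·(polynomial with one Descartes sign change)` with non-negative `t^{-3/2}`-mass
  (`stub_cert_analytic`, `stub_cert_crossing`); such mixtures are positive definite in sum by a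
  Chebyshev rearrangement (`stub_engine`) against the monotonicity of `t ↦ t^{3/2} Σ e^{-t d²}`,
  which is Mathlib's Gaussian Fourier integral on `EuclideanSpace ℝ (Fin 3)` (`stub_gaussSum_mono`).
* The Hermite dipole piece `c₁ (u - uₛ) e^{-t₀u}` (`c₁ ≤ 0`, `t₀ uₛ ≥ 3/2`) is positive definite in
  sum by the same monotonicity, differentiated once (`stub_hermite_pd`).
* `g ≤ V_LJ` is checked in three regions with the Taylor envelopes of `e^{-t₀u}`
  (`exp_neg_le_inv_taylor`, `exp_le_taylor_add` = Mathlib `Real.sum_le_exp_of_nonneg`,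
  `Complex.exp_bound'`), each a univariate polynomial inequality certified by a Markov–Lukács
  identity `f² + s g² + E` (`stub_cert_numeric`).
No sitewise bound, no separation hypothesis, no Delaunay cells: injectivity enters only at the
pair comparison and `d = 3` through the exponent `3/2` (the `ℝ⁴` analogue is false, crux
`Disproof.lean` §3).
-/

noncomputable section

namespace Summit.AtomisticToContinuum.Crystallization.Theorems

open MeasureTheory Set Real
open scoped Nat
open Literature.MathematicalPhysics.StatisticalMechanics

/-- Taylor envelope from above for `e^{-x}`, `x ≥ 0`: `e^{-x} ≤ 1 / Σ_{i≤m} xⁱ/i!`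
(`Real.sum_le_exp_of_nonneg`). -/
theorem exp_neg_le_inv_taylor {x : ℝ} (hx : 0 ≤ x) (m : ℕ) :
    Real.exp (-x) ≤ 1 / ∑ i ∈ Finset.range (m + 1), x ^ i / (i ! : ℝ) := by
  have hT : ∑ i ∈ Finset.range (m + 1), x ^ i / (i ! : ℝ) ≤ Real.exp x :=
    Real.sum_le_exp_of_nonneg hx (m + 1)
  have hpos : 0 < ∑ i ∈ Finset.range (m + 1), x ^ i / (i ! : ℝ) := by
    rw [Finset.sum_range_succ']
    have : 0 ≤ ∑ i ∈ Finset.range m, x ^ (i + 1) / ((i + 1)! : ℝ) :=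
      Finset.sum_nonneg fun i _ => by positivity
    simpa using by positivity
  rw [Real.exp_neg, inv_eq_one_div]
  exact one_div_le_one_div_of_le hpos hT

/-- Taylor envelope from above for `e^{x}`, `0 ≤ x ≤ (n+1)/2`:
`e^{x} ≤ Σ_{i<n} xⁱ/i! + 2 xⁿ/n!` (real form of `Complex.exp_bound'`). -/
theorem exp_le_taylor_add {x : ℝ} (hx : 0 ≤ x) {n : ℕ} (hxn : 2 * x ≤ n + 1) :
    Real.exp x ≤ ∑ i ∈ Finset.range n, x ^ i / (i ! : ℝ) + x ^ n / (n ! : ℝ) * 2 := by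
  have hx' : ‖(x : ℂ)‖ / (n.succ : ℕ) ≤ 1 / 2 := by
    rw [Complex.norm_real, Real.norm_eq_abs, abs_of_nonneg hx, Nat.cast_succ,
      div_le_div_iff₀ (by positivity) (by norm_num)]
    linarith
  have h := Complex.exp_bound' hx'
  have hre : (Complex.exp x - ∑ m ∈ Finset.range n, (x : ℂ) ^ m / (m.factorial : ℂ)).re =
      Real.exp x - ∑ i ∈ Finset.range n, x ^ i / (i ! : ℝ) := by
    rw [Complex.sub_re, ← Complex.ofReal_exp, Complex.ofReal_re, Complex.re_sum]
    congr 1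
    refine Finset.sum_congr rfl fun i _ => ?_
    rw [← Complex.ofReal_pow, ← Complex.ofReal_natCast, ← Complex.ofReal_div, Complex.ofReal_re]
  have h1 : Real.exp x - ∑ i ∈ Finset.range n, x ^ i / (i ! : ℝ) ≤ ‖(x : ℂ)‖ ^ n / (n ! : ℝ) * 2 := by
    rw [← hre]; exact (Complex.re_le_norm _).trans h
  rw [Complex.norm_real, Real.norm_eq_abs, abs_of_nonneg hx] at h1
  linarith

/-- **Crux `StabilityConstantTwelve` (item stmt-AtomisticToContinuum-13601)**: `E(N) ≥ -N` for
the Lennard-Jones ground-state energy of `N` distinct points in `ℝ³` (Blanc–Lewin units) — the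
composition of the line `Sketch`: hybrid two-point certificate, positive definiteness in sum by
one-crossing Gaussian subordination + Hermite dipole, minorant inequality by regions, reduction. -/
theorem StabilityConstantTwelve_of :
    Summit.AtomisticToContinuum.Crystallization.Theses.ReggeStarCoercivity.StabilityConstantTwelve := by
  obtain ⟨t₀, uₛ, u₁, c₁, σ, m, n, K, k, b, ht₀, hc₁, hpd0, huₛ, hu₁, hn, hσ, hneg, hpos, hex_neg,
    hex_pos, hmass, hA, hB, hC, hval⟩ := stub_cert_numeric
  -- the rational piece: density and Gaussian mixture
  set a : ℝ → ℝ := fun t => Real.exp (-(σ * t)) *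
      ∑ q ∈ Finset.range K, b q * σ ^ (q + 2) * t ^ (q + 1) / ((q + 1)! : ℝ) with ha_def
  set R : ℝ → ℝ := fun u => ∑ q ∈ Finset.range K, b q * (σ / (σ + u)) ^ (q + 2) with hR_def
  -- the Hermite piece and the full certificate
  set h : ℝ → ℝ := fun u => c₁ * (u - uₛ) * Real.exp (-(t₀ * u)) with hh_def
  set g : ℝ → ℝ := fun u => h u + R u with hg_def
  obtain ⟨ha_int, ha_int', ha_mass, ha_repr⟩ := stub_cert_analytic σ hσ K b a ha_def
  obtain ⟨t₁, ht₁, ha_neg, ha_pos⟩ := stub_cert_crossing σ hσ K k b hneg hpos hex_neg hex_pos a ha_def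
  have hmass' : 0 ≤ ∫ t in Ioi 0, a t * t ^ (-(3 / 2 : ℝ)) := by
    rw [ha_mass]
    have h1 : 0 ≤ σ ^ ((3 : ℝ) / 2) := by positivity
    have h2 : 0 ≤ √π := Real.sqrt_nonneg _
    exact mul_nonneg (mul_nonneg h1 h2) hmass
  -- positive definiteness in sum of both pieces
  have hpdR : ∀ (N : ℕ) (x : Fin N → EuclideanSpace ℝ (Fin 3)),
      0 ≤ ∑ i, ∑ j, R (‖x i - x j‖ ^ 2) := by
    intro N x
    have hrw : ∀ i j : Fin N, R (‖x i - x j‖ ^ 2) =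
        ∫ t in Ioi 0, Real.exp (-(t * ‖x i - x j‖ ^ 2)) * a t := fun i j =>
      (ha_repr _ (sq_nonneg _)).symm
    simp_rw [hrw]
    exact stub_engine a t₁ ht₁ ha_neg ha_pos ha_int ha_int' hmass'
      (fun N x t₁ t₂ h₁ h₁₂ => stub_gaussSum_mono N x h₁ h₁₂) N x
  have hpd : ∀ (N : ℕ) (x : Fin N → EuclideanSpace ℝ (Fin 3)),
      0 ≤ ∑ i, ∑ j, g (‖x i - x j‖ ^ 2) := by
    intro N x
    have hsplit : ∑ i, ∑ j, g (‖x i - x j‖ ^ 2) =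
        (∑ i, ∑ j, c₁ * (‖x i - x j‖ ^ 2 - uₛ) * Real.exp (-(t₀ * ‖x i - x j‖ ^ 2))) +
          ∑ i, ∑ j, R (‖x i - x j‖ ^ 2) := by
      rw [← Finset.sum_add_distrib]
      refine Finset.sum_congr rfl fun i _ => ?_
      rw [← Finset.sum_add_distrib]
    rw [hsplit]
    exact add_nonneg (stub_hermite_pd t₀ uₛ c₁ ht₀ hc₁ hpd0 N x) (hpdR N x)
  -- the minorant inequality, by regions
  have hle : ∀ r : ℝ, 0 < r → g (r ^ 2) ≤ lennardJones r := by
    intro r hr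
    have hx0 : 0 ≤ t₀ * r ^ 2 := by positivity
    show h (r ^ 2) + R (r ^ 2) ≤ lennardJones r
    rcases le_or_gt (r ^ 2) uₛ with hAu | hBu
    · -- region A: `c₁ (u - uₛ) ≥ 0`, envelope from above
      have hfac : 0 ≤ c₁ * (r ^ 2 - uₛ) := mul_nonneg_of_nonpos_of_nonpos hc₁ (by linarith)
      have hT : 0 < ∑ i ∈ Finset.range (m + 1), (t₀ * r ^ 2) ^ i / (i ! : ℝ) := by
        rw [Finset.sum_range_succ']
        have : 0 ≤ ∑ i ∈ Finset.range m, (t₀ * r ^ 2) ^ (i + 1) / ((i + 1)! : ℝ) :=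
          Finset.sum_nonneg fun i _ => by positivity
        simpa using by positivity
      have henv := exp_neg_le_inv_taylor hx0 m
      have hh : h (r ^ 2) ≤ c₁ * (r ^ 2 - uₛ) / ∑ i ∈ Finset.range (m + 1), (t₀ * r ^ 2) ^ i / (i ! : ℝ) := by
        show c₁ * (r ^ 2 - uₛ) * Real.exp (-(t₀ * r ^ 2)) ≤ _
        rw [div_eq_mul_one_div]
        exact mul_le_mul_of_nonneg_left henv hfac
      linarith [hA r hr hAu]
    rcases le_or_gt (r ^ 2) u₁ with hBu' | hCu
    · -- region B: `c₁ (u - uₛ) ≤ 0`, envelope from below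
      have hfac : c₁ * (r ^ 2 - uₛ) ≤ 0 := mul_nonpos_of_nonpos_of_nonneg hc₁ (by linarith)
      have hxn : 2 * (t₀ * r ^ 2) ≤ n + 1 := by nlinarith
      have hup := exp_le_taylor_add hx0 hxn
      set T := ∑ i ∈ Finset.range n, (t₀ * r ^ 2) ^ i / (i ! : ℝ) + (t₀ * r ^ 2) ^ n / (n ! : ℝ) * 2
        with hT_def
      have hTpos : 0 < T := (Real.exp_pos _).trans_le hup
      have henv : 1 / T ≤ Real.exp (-(t₀ * r ^ 2)) := by
        rw [Real.exp_neg, ← one_div]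
        exact one_div_le_one_div_of_le (Real.exp_pos _) hup
      have hh : h (r ^ 2) ≤ c₁ * (r ^ 2 - uₛ) / T := by
        show c₁ * (r ^ 2 - uₛ) * Real.exp (-(t₀ * r ^ 2)) ≤ _
        rw [div_eq_mul_one_div]
        exact mul_le_mul_of_nonpos_left henv hfac
      linarith [hB r hr hBu.le hBu']
    · -- region C: `h ≤ 0`
      have hh : h (r ^ 2) ≤ 0 := by
        show c₁ * (r ^ 2 - uₛ) * Real.exp (-(t₀ * r ^ 2)) ≤ 0
        exact mul_nonpos_of_nonpos_of_nonneg
          (mul_nonpos_of_nonpos_of_nonneg hc₁ (by linarith)) (Real.exp_pos _).le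
      linarith [hC r hr hCu.le]
  have hg0 : g 0 ≤ 2 := by
    have hR0 : R 0 = ∑ q ∈ Finset.range K, b q := by
      rw [hR_def]
      refine Finset.sum_congr rfl fun q _ => ?_
      rw [add_zero, div_self hσ.ne', one_pow, mul_one]
    have hh0 : h 0 = -(c₁ * uₛ) := by
      show c₁ * (0 - uₛ) * Real.exp (-(t₀ * 0)) = -(c₁ * uₛ)
      rw [mul_zero, neg_zero, Real.exp_zero]; ring
    show h 0 + R 0 ≤ 2
    rw [hh0, hR0]; exact hval
  -- reduction and the infimum over distinct configurations
  unfold Summit.AtomisticToContinuum.Crystallization.Theses.ReggeStarCoercivity.StabilityConstantTwelve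
  intro N
  haveI := nonempty_injective_config (d := 3) (by norm_num) N
  exact le_ciInf fun y => stub_reduction g hpd hle hg0 N y.1 y.2

/-- **Crux `StabilityConstantTwelve`**, closing form (`<decl>_proof` naming of the prover
protocol): `∀ N, -(N:ℝ) ≤ groundStateEnergy lennardJones 3 N`. -/
theorem stabilityConstantTwelve_proof :
    Summit.AtomisticToContinuum.Crystallization.Theses.ReggeStarCoercivity.StabilityConstantTwelve :=
  StabilityConstantTwelve_of

end Summit.AtomisticToContinuum.Crystallization.Theorems
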